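import Summits.HodgeConjecture.HodgeConjecture.Theorems.F0P3cStCharTSWeylCartanDatumWIF      -- ★ (E4) `weylIntegrationFormula_of_cartanFinset_of_tubeJacobians` (F0P3a-p05)
import Summits.HodgeConjecture.HodgeConjecture.Theorems.F0P3cStCharTSWeylHypJacobianCartanM   -- ★ (J6) FILE 7 `tubeJacobianLocal_cartan_Gqs_vanDijkWeight_sq` (LH6-p04): the split-Cartan slot, unconditional (brings ★ ADAPTER-M, ★ FILE 6)
import Summits.HodgeConjecture.HodgeConjecture.Theorems.F0P3cStCharTSWeightIdElliptic        -- ★ `DG_sq_eq_sqrt` (LH6-p02)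
import Summits.HodgeConjecture.HodgeConjecture.Theorems.F0P3cStCharTSDGField                 -- ★ DG-FIELD `DG_coe_torus_eq_vanDijkWeight_re`, `dgFormula_eq_zero_of_not_isUnit_discr`, `continuous_dgFormula` (LH4-p02)
import Summits.HodgeConjecture.HodgeConjecture.Theorems.F0P3cStCharTSDGFieldReg              -- ★ `isUnit_charpoly_discr_iff_isRegularElt` (LH4-p02)
import Summits.HodgeConjecture.HodgeConjecture.Theorems.F0P3cStCharTSVanDijkWeylSymm          -- ★ `exists_weylElt`
import HarnessLib

/-!
# F0 · P3c · line LH6 «StCharTS» — «WIF AT THE DATUM PINS»: the block antecedent `hWIF : 𝔇.WeylIntegrationFormula` from the datum's field pins, the split-Cartan tube Jacobian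
# (★ road JAC-LOC, unconditional) and ONE named input — the compact-Cartan tube-Jacobian socket `hJacT` (JAC-ELL C8's head, letters signed 2026-09-02T18:06Z)
# (Rogawski 1990 §12.5 p. 182; Harish-Chandra 1970 Lemmas 20, 22, 42)

Cell `pub/hodgecm-mathlib`, crux H413 = `stmt-HodgeConjecture-24833` (lane `--supports … --as helper`); seat LH5-p02 (g7) (JAC-ELL holder by lineage); the WISHED HEAD of the
junction∕RUNG0 pen LH6-p01 (g5) (2026-09-02T17:05:26Z, «= YOURS» 18:07:09Z), booked by LEAD T14-15.  THEOREMS ONLY; sorry-free; no definition ∕ instance ∕ notation ∕ named fact;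
★-only imports; axioms TRIO.

THE POINT.  ★ (E4) `weylIntegrationFormula_of_cartanFinset_of_tubeJacobians` proves `𝔇.WeylIntegrationFormula` for any datum whose fields are pinned to a finite irredundant covering
family `S` of Cartan subgroups `Z(γ₀)`, given PER-REPRESENTATIVE data (conjugation families `Φ`, normalised Haar measures, weights) and the local tube-Jacobian sockets `hJac`.  Here:
* `S := 𝔇.cartanAll` itself (binders `hShape` ∕ `hcovA` ∕ `hncA` = ★ CARTAN-ALL's three clauses, `hcptA` the compactness pin of the non-split members, `hHaarT` ∕ `hinvT` ∕ `hcoreT`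
  the torus-measure pins — all discharged at RUNG0 from ★ INSTANTIATE-CARTAN `exists_cartanInputs₂`);
* `Φ` is CONSTRUCTED (★ `exists_conjFamily`; each `Z(γ₀)` is abelian, ★ `mul_comm_of_mem_centralizer`);
* the weight is the LETTER `D_T t := √(∏_w |disc χ_t|_w · (∏_w |det t|_w)⁻²)`, so `(𝔇.DG t)² = D_T t` is ★ `DG_sq_eq_sqrt` under the field equation `eDG` (★ RUNG0's text) and
  `𝔇.DG = 0` off the regular set is ★ DG-FIELD;
* the socket at the SPLIT Cartan `M` is DISCHARGED by ★ (J6) FILE 7 `tubeJacobianLocal_cartan_Gqs_vanDijkWeight_sq` (road JAC-LOC, LH6-p03∕LH6-p04), the weight matched on `M` by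
  ★ `DG_coe_torus_eq_vanDijkWeight_re`; the Weyl representative by ★ `exists_weylElt`;
* the sockets at the COMPACT Cartans are the ONE named input `hJacT` — the C8 head letters of road JAC-ELL (sigsheet `F0/P3c/LH5/LH5-p02/g7/JACELL-C8-LETTERS.sigsheet.v1`
  158545636702c2e4), Φ-free set-builder tube, `∀` Haar torus measure, datum-free; when C8 is ★ the junction deletes it by `hJacT := …tubeJacobianSocket_compactCartan L v hns νQv`.
HONEST LABEL: count-neutral; R90 block consequents 11 → 10 at junction v7; + HC1970 tube-Jacobian socket ×1 (`hJacT`) until JAC-ELL C8 ★; closes no organ by itself.  HC_CM is proved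
only modulo the 7 printed citations (2 remaining: hLiu418 = `stmt-HodgeConjecture-24832`, h413 = `stmt-HodgeConjecture-24833`) until rung 0 closes.

## References
* [Rogawski1990] J. D. Rogawski, *Automorphic Representations of Unitary Groups in Three Variables*, Ann. of Math. Stud. 123 (1990), §12.5 p. 182 (Weyl integration formula), §3.6
  pp. 28–31, §4.9 p. 54.
* [HarishChandra1970] Harish-Chandra (notes by G. van Dijk), *Harmonic analysis on reductive p-adic groups*, LNM 162 (1970), Part V §3 Lemma 20, §4 Lemma 22, Lemma 42.
-/

set_option autoImplicit false
-- the mandated namespace has the single-problem summit's repeated segment (`HodgeConjecture.HodgeConjecture`)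
set_option linter.dupNamespace false

noncomputable section

open MeasureTheory Measure Set Filter Topology Function NumberField IsDedekindDomain Matrix Polynomial
open Literature.MeasureTheory.Group
open Literature.NumberTheory.Automorphic Literature.NumberTheory.Automorphic.UnitaryGroup Literature.NumberTheory.Rogawski1990
open Summit.HodgeConjecture.HodgeConjecture.Cruxes.H413
open Summit.HodgeConjecture.HodgeConjecture.Cruxes.H413.F0P3cStCharTSWeylCartanRadial
open Summit.HodgeConjecture.HodgeConjecture.Cruxes.H413.F0P3cStCharTSWeylCartanDatumWIF
open Summit.HodgeConjecture.HodgeConjecture.Cruxes.H413.F0P3cStCharTSWeylHypMeasure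
open Summit.HodgeConjecture.HodgeConjecture.Cruxes.H413.F0P3cStCharTSWeylHypJacobianCartanM
open scoped ENNReal NNReal MatrixGroups Pointwise

namespace Summit.HodgeConjecture.HodgeConjecture.Cruxes.H413.F0P3cStCharTSWeylDatumPinsWIF

section CM

variable (L : Type) [Field L] [NumberField L] [IsCMField L] (v : HeightOneSpectrum (𝓞 ↥(maximalRealSubfield L)))

/-! ## §1 The weight letter `D(g) = √(∏_w |disc χ_g|_w · (∏_w |det g|_w)⁻²)` is measurable -/

/-- The weight letter `g ↦ √(∏_w |disc χ_g|_w · (∏_w |det g|_w)⁻²)` is continuous on `U(Φ₃)(L⁺_v)`: it is the square of ★ DG-FIELD's continuous closed form `√√(·)`.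
[cite: Rogawski1990, §4.9 p. 54; §12.5 p. 182] -/
theorem continuous_sqrt_dgRadicand :
    Continuous fun g : Gqs L v => NNReal.sqrt
      ((∏ w : PlacesOver L v, Literature.NumberTheory.GaloisRepresentations.IsNonarchimedeanLocalField.normAbs (w.1.adicCompletion L)
          (((g.val : GL (Fin 3) (UnitaryGroup.LocalRing L v)).val.charpoly.discr) w)) *
        ((∏ w : PlacesOver L v, Literature.NumberTheory.GaloisRepresentations.IsNonarchimedeanLocalField.normAbs (w.1.adicCompletion L)
          (((g.val : GL (Fin 3) (UnitaryGroup.LocalRing L v)).val.det) w)) ^ 2)⁻¹) := by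
  have h2 := (continuous_real_toNNReal.comp (F0P3cStCharTSDGField.continuous_dgFormula L v)).pow 2
  convert h2 using 1
  funext g
  simp only [Pi.pow_apply, Function.comp_apply, Real.toNNReal_coe, NNReal.sq_sqrt]

/-! ## §2 The head: `𝔇.WeylIntegrationFormula` from the datum pins, the split-Cartan Jacobian (★) and the compact-Cartan socket `hJacT` -/

set_option maxHeartbeats 1600000 in
set_option synthInstance.maxHeartbeats 400000 in
-- instance-term unification on the CM local carrier (as ★ (E4))
/-- **«WIF AT THE DATUM PINS».**  For the organ's datum `𝔇` on `G = Gqs L v = U(Φ₃)(L⁺_v)` (`v` non-split, `hns`), with Haar measure `νQv` and the canonical orbital measures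
`mQv` (`hcanQ`): IF the fields are pinned — `𝔇.μG = νQv` (`hC01`), `𝔇.orb = mQv` (`hC04`), `𝔇.regG = {regular}` (`hC05`), every `T ∈ 𝔇.cartanAll` is `Z(γ₀)` with `γ₀` regular
(`hShape`), `𝔇.cartanAll` meets every regular class (`hcovA`) and is irredundant (`hncA`), its members `≠ M` are compact (`hcptA`), each `𝔇.μT T` is a Haar measure (`hHaarT`) with
inversion symmetry (`hinvT`) and mass one on the compact core (`hcoreT`), `𝔇.DG` is the closed form (`eDG`) — AND the compact-Cartan tube-Jacobian socket `hJacT` holds (JAC-ELL C8's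
head, Φ-free letters, weight `√(∏_w |disc|_w (∏_w |det|_w)⁻²)`), THEN `𝔇.WeylIntegrationFormula`:
`∫ f α ∂𝔇.μG = Σ_{T ∈ 𝔇.cartanAll} (weylOrder T)⁻¹ ∫_T (𝔇.DG t)² 𝔇.orbInt t f α t ∂(𝔇.μT T)`.  PROOF: ★ (E4) at `S := 𝔇.cartanAll` with `Φ` by ★ `exists_conjFamily`, the
split slot by ★ (J6) FILE 7 (Weyl representative ★ `exists_weylElt`, weight on `M` by ★ `DG_coe_torus_eq_vanDijkWeight_re` + ★ `DG_sq_eq_sqrt`), the compact slots by `hJacT`.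
[cite: Rogawski1990, §12.5 p. 182; §3.6 pp. 28–31] [cite: HarishChandra1970, Lemma 20; Lemma 22; Lemma 42] -/
theorem weylIntegrationFormula_of_datumPins
    (hns : ∀ w : PlacesOver L v, IsCMField.complexConj L • w.1 = w.1)
    [MeasurableSpace (Gqs L v)] [BorelSpace (Gqs L v)] [LocallyCompactSpace (Gqs L v)] [SecondCountableTopology (Gqs L v)] [T2Space (Gqs L v)]
    [∀ γ' : Gqs L v, MeasurableSpace (Gqs L v ⧸ Subgroup.centralizer ({γ'} : Set (Gqs L v)))]
    [∀ γ' : Gqs L v, BorelSpace (Gqs L v ⧸ Subgroup.centralizer ({γ'} : Set (Gqs L v)))]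
    [MeasurableSpace (Gqs L v ⧸ Subgroup.center (Gqs L v))]
    (νQv : Measure (Gqs L v)) [νQv.IsHaarMeasure] [νQv.IsMulRightInvariant]
    {Hv : Type} [Group Hv] [TopologicalSpace Hv] [IsTopologicalGroup Hv] [MeasurableSpace Hv]
    (mQv : OrbitalMeasureFamily (Gqs L v))
    (𝔇 : Ch12Sec5.EllipticData (Gqs L v) Hv)
    (hC01 : 𝔇.μG = νQv)
    (hC04 : 𝔇.orb = mQv)
    (hcanQ : mQv.IsCanonical (fun γ : Gqs L v => IsRegularElt (γ.val : GL (Fin 3) (UnitaryGroup.LocalRing L v))) νQv)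
    (hC05 : ∀ γ : Gqs L v, γ ∈ 𝔇.regG ↔ IsRegularElt (γ.val : GL (Fin 3) (UnitaryGroup.LocalRing L v)))
    (hShape : ∀ T ∈ 𝔇.cartanAll, ∃ γ₀ : Gqs L v, IsRegularElt (γ₀.val : GL (Fin 3) (UnitaryGroup.LocalRing L v)) ∧ T = Subgroup.centralizer ({γ₀} : Set (Gqs L v)))
    (hcovA : ∀ γ : Gqs L v, IsRegularElt (γ.val : GL (Fin 3) (UnitaryGroup.LocalRing L v)) →
      ∃ T ∈ 𝔇.cartanAll, ∃ x : Gqs L v, ∀ g : Gqs L v, g ∈ Subgroup.centralizer ({γ} : Set (Gqs L v)) ↔ x⁻¹ * g * x ∈ T)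
    (hncA : ∀ T ∈ 𝔇.cartanAll, ∀ T' ∈ 𝔇.cartanAll, T ≠ T' → ∀ y : Gqs L v, ¬ ∀ h : Gqs L v, h ∈ T' ↔ y⁻¹ * h * y ∈ T)
    (hcptA : ∀ T ∈ 𝔇.cartanAll, T ≠ (cmBorelTriple L 3 v).M → IsCompact (T : Set (Gqs L v)))
    (hHaarT : ∀ T ∈ 𝔇.cartanAll, (𝔇.μT T).IsHaarMeasure)
    (hinvT : ∀ T ∈ 𝔇.cartanAll, (𝔇.μT T).IsInvInvariant)
    (hcoreT : ∀ T ∈ 𝔇.cartanAll, 𝔇.μT T (compactCore ↥T) = 1)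
    (eDG : ∀ g : Gqs L v, 𝔇.DG g = ((NNReal.sqrt (NNReal.sqrt ((∏ w : PlacesOver L v, Literature.NumberTheory.GaloisRepresentations.IsNonarchimedeanLocalField.normAbs (w.1.adicCompletion L) (((g.val : GL (Fin 3) (UnitaryGroup.LocalRing L v)).val.charpoly.discr) w)) * ((∏ w : PlacesOver L v, Literature.NumberTheory.GaloisRepresentations.IsNonarchimedeanLocalField.normAbs (w.1.adicCompletion L) (((g.val : GL (Fin 3) (UnitaryGroup.LocalRing L v)).val.det) w)) ^ 2)⁻¹)) : ℝ≥0) : ℝ))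
    (hJacT : ∀ (T : Subgroup (Gqs L v)) (γ₀ : Gqs L v) (_ : IsRegularElt (γ₀.val : GL (Fin 3) (UnitaryGroup.LocalRing L v)))
      (_ : T = Subgroup.centralizer ({γ₀} : Set (Gqs L v))) (hTcpt : IsCompact (T : Set (Gqs L v))),
      (letI : MeasurableSpace (Gqs L v ⧸ T) := borel _; haveI : BorelSpace (Gqs L v ⧸ T) := ⟨rfl⟩;
      ∀ (tT : Measure ↥T) (_ : tT.IsHaarMeasure) (_ : tT.IsInvInvariant), tT (compactCore ↥T) = 1 →
        ∀ t₀ : ↥T, IsRegularElt (((t₀ : Gqs L v)).val : GL (Fin 3) (UnitaryGroup.LocalRing L v)) →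
        ∃ U : Set ↥T, IsOpen U ∧ t₀ ∈ U ∧
        ∃ A₀ : Set (Gqs L v ⧸ T), MeasurableSet A₀ ∧
          quotientMeasure T tT hTcpt.isClosed νQv A₀ ≠ 0 ∧ quotientMeasure T tT hTcpt.isClosed νQv A₀ ≠ ∞ ∧
          ∀ V : Set ↥T, MeasurableSet V → V ⊆ U →
            (∀ t ∈ V, IsRegularElt (((t : Gqs L v)).val : GL (Fin 3) (UnitaryGroup.LocalRing L v))) →
            (∀ n : Gqs L v, n ∉ T → ∀ t ∈ V, ∀ t' ∈ V, ((t' : ↥T) : Gqs L v) ≠ n * t * n⁻¹) →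
              νQv {y : Gqs L v | ∃ (x : Gqs L v) (t : ↥T), (QuotientGroup.mk x : Gqs L v ⧸ T) ∈ A₀ ∧ t ∈ V ∧ y = x * t * x⁻¹} =
                quotientMeasure T tT hTcpt.isClosed νQv A₀ *
                  ∫⁻ t in V, ((NNReal.sqrt
                    ((∏ w : PlacesOver L v, Literature.NumberTheory.GaloisRepresentations.IsNonarchimedeanLocalField.normAbs (w.1.adicCompletion L)
                        ((((t : Gqs L v).val : GL (Fin 3) (UnitaryGroup.LocalRing L v)).val.charpoly.discr) w)) *
                      ((∏ w : PlacesOver L v, Literature.NumberTheory.GaloisRepresentations.IsNonarchimedeanLocalField.normAbs (w.1.adicCompletion L)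
                        ((((t : Gqs L v).val : GL (Fin 3) (UnitaryGroup.LocalRing L v)).val.det) w)) ^ 2)⁻¹) : ℝ≥0) : ℝ≥0∞) ∂tT)) :
    𝔇.WeylIntegrationFormula := by
  classical
  -- ### (1) the Weyl representative of `U(Φ₃)` (for the split slot)
  obtain ⟨w₀, hw₀⟩ := F0P3cStCharTSVanDijkWeylSymm.exists_weylElt L v
  -- ### (2) the conjugation families: every `T ∈ 𝔇.cartanAll` is `Z(γ₀)`, hence abelian
  have hab : ∀ T : ↥𝔇.cartanAll, ∀ a ∈ (T : Subgroup (Gqs L v)), ∀ b ∈ (T : Subgroup (Gqs L v)), a * b = b * a := by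
    intro T a ha b hb
    obtain ⟨γ₀, hγ₀, hT⟩ := hShape T T.2
    rw [hT] at ha hb
    exact mul_comm_of_mem_centralizer L v hγ₀ a ha b hb
  choose Φ hΦ using fun T : ↥𝔇.cartanAll => exists_conjFamily (T : Subgroup (Gqs L v)) (hab T)
  -- ### (3) the per-representative instances: Haar ∕ inversion-symmetric torus measures, Borel quotients
  haveI hH : ∀ T : ↥𝔇.cartanAll, (𝔇.μT (T : Subgroup (Gqs L v))).IsHaarMeasure := fun T => hHaarT T T.2
  haveI hI : ∀ T : ↥𝔇.cartanAll, (𝔇.μT (T : Subgroup (Gqs L v))).IsInvInvariant := fun T => hinvT T T.2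
  letI hmsQ : ∀ T : ↥𝔇.cartanAll, MeasurableSpace (Gqs L v ⧸ (T : Subgroup (Gqs L v))) := fun _ => borel _
  haveI hbQ : ∀ T : ↥𝔇.cartanAll, BorelSpace (Gqs L v ⧸ (T : Subgroup (Gqs L v))) := fun _ => ⟨rfl⟩
  -- ### (4) the weight letter and its pins
  have hD : ∀ T : ↥𝔇.cartanAll, Measurable fun t : ↥(T : Subgroup (Gqs L v)) => NNReal.sqrt
      ((∏ w : PlacesOver L v, Literature.NumberTheory.GaloisRepresentations.IsNonarchimedeanLocalField.normAbs (w.1.adicCompletion L)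
          ((((t : Gqs L v).val : GL (Fin 3) (UnitaryGroup.LocalRing L v)).val.charpoly.discr) w)) *
        ((∏ w : PlacesOver L v, Literature.NumberTheory.GaloisRepresentations.IsNonarchimedeanLocalField.normAbs (w.1.adicCompletion L)
          ((((t : Gqs L v).val : GL (Fin 3) (UnitaryGroup.LocalRing L v)).val.det) w)) ^ 2)⁻¹) :=
    fun T => (continuous_sqrt_dgRadicand L v).measurable.comp measurable_subtype_coe
  have hDGsq : ∀ (T : ↥𝔇.cartanAll) (t : ↥(T : Subgroup (Gqs L v))), IsRegularElt (((t : Gqs L v)).val : GL (Fin 3) (UnitaryGroup.LocalRing L v)) →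
      𝔇.DG (t : Gqs L v) ^ 2 = ((NNReal.sqrt
        ((∏ w : PlacesOver L v, Literature.NumberTheory.GaloisRepresentations.IsNonarchimedeanLocalField.normAbs (w.1.adicCompletion L)
            ((((t : Gqs L v).val : GL (Fin 3) (UnitaryGroup.LocalRing L v)).val.charpoly.discr) w)) *
          ((∏ w : PlacesOver L v, Literature.NumberTheory.GaloisRepresentations.IsNonarchimedeanLocalField.normAbs (w.1.adicCompletion L)
            ((((t : Gqs L v).val : GL (Fin 3) (UnitaryGroup.LocalRing L v)).val.det) w)) ^ 2)⁻¹) : ℝ≥0) : ℝ) :=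
    fun T t _ => F0P3cStCharTSWeightIdElliptic.DG_sq_eq_sqrt L v 𝔇 eDG (t : Gqs L v)
  have hDG0 : ∀ (T : ↥𝔇.cartanAll) (t : ↥(T : Subgroup (Gqs L v))), ¬ IsRegularElt (((t : Gqs L v)).val : GL (Fin 3) (UnitaryGroup.LocalRing L v)) →
      𝔇.DG (t : Gqs L v) = 0 := by
    intro T t ht
    rw [eDG]
    exact F0P3cStCharTSDGField.dgFormula_eq_zero_of_not_isUnit_discr L v _ fun hu =>
      ht ((F0P3cStCharTSDGFieldReg.isUnit_charpoly_discr_iff_isRegularElt L v _).1 hu)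
  have hreg : 𝔇.regG = {g : Gqs L v | IsRegularElt (g.val : GL (Fin 3) (UnitaryGroup.LocalRing L v))} := Set.ext fun g => hC05 g
  have hcanQ' : 𝔇.orb.IsCanonical (fun γ' : Gqs L v => IsRegularElt (γ'.val : GL (Fin 3) (UnitaryGroup.LocalRing L v))) νQv := by
    rw [hC04]; exact hcanQ
  -- ### (5) ★ (E4) at `S := 𝔇.cartanAll`; only the sockets remain
  refine weylIntegrationFormula_of_cartanFinset_of_tubeJacobians 𝔇.cartanAll hShape hcovA hncA hns νQv Φ hΦ
    (fun T => 𝔇.μT (T : Subgroup (Gqs L v))) (fun T => hcoreT T T.2)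
    (fun T t => NNReal.sqrt
      ((∏ w : PlacesOver L v, Literature.NumberTheory.GaloisRepresentations.IsNonarchimedeanLocalField.normAbs (w.1.adicCompletion L)
          ((((t : Gqs L v).val : GL (Fin 3) (UnitaryGroup.LocalRing L v)).val.charpoly.discr) w)) *
        ((∏ w : PlacesOver L v, Literature.NumberTheory.GaloisRepresentations.IsNonarchimedeanLocalField.normAbs (w.1.adicCompletion L)
          ((((t : Gqs L v).val : GL (Fin 3) (UnitaryGroup.LocalRing L v)).val.det) w)) ^ 2)⁻¹))
    hD 𝔇 hC01 hcanQ' hreg rfl (fun T => rfl) hDGsq hDG0 ?_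
  intro T t₀ ht₀
  by_cases hTM : (T : Subgroup (Gqs L v)) = (cmBorelTriple L 3 v).M
  · -- ### (6a) the SPLIT Cartan `M`: ★ (J6) FILE 7 (road JAC-LOC), weight matched on `M` by ★ `DG_coe_torus_eq_vanDijkWeight_re` + ★ `DG_sq_eq_sqrt`
    have hDM : ∀ t' : ↥(cmBorelTriple L 3 v).M, ((NNReal.sqrt
        ((∏ w : PlacesOver L v, Literature.NumberTheory.GaloisRepresentations.IsNonarchimedeanLocalField.normAbs (w.1.adicCompletion L)
            (((((t' : ↥(unitaryGroupOfForm (conjLocal L (IsCMField.complexConj L) v) (cmLocalForm L 3 v))) : Gqs L v).val :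
              GL (Fin 3) (UnitaryGroup.LocalRing L v)).val.charpoly.discr) w)) *
          ((∏ w : PlacesOver L v, Literature.NumberTheory.GaloisRepresentations.IsNonarchimedeanLocalField.normAbs (w.1.adicCompletion L)
            (((((t' : ↥(unitaryGroupOfForm (conjLocal L (IsCMField.complexConj L) v) (cmLocalForm L 3 v))) : Gqs L v).val :
              GL (Fin 3) (UnitaryGroup.LocalRing L v)).val.det) w)) ^ 2)⁻¹) : ℝ≥0) : ℝ) =
        ((F0P3cStCharTSTorusDefs.vanDijkWeight L v t').re) ^ 2 := by
      intro t'
      rw [← F0P3cStCharTSDGField.DG_coe_torus_eq_vanDijkWeight_re L v hns 𝔇 eDG t',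
        F0P3cStCharTSWeightIdElliptic.DG_sq_eq_sqrt L v 𝔇 eDG]
    exact tubeJacobianLocal_cartan_Gqs_vanDijkWeight_sq L v hns νQv hTM _ (Φ T) (hΦ T) (𝔇.μT (T : Subgroup (Gqs L v))) (hcoreT T T.2) w₀ hw₀
      (fun t' => NNReal.sqrt
        ((∏ w : PlacesOver L v, Literature.NumberTheory.GaloisRepresentations.IsNonarchimedeanLocalField.normAbs (w.1.adicCompletion L)
            (((((t' : ↥(unitaryGroupOfForm (conjLocal L (IsCMField.complexConj L) v) (cmLocalForm L 3 v))) : Gqs L v).val :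
              GL (Fin 3) (UnitaryGroup.LocalRing L v)).val.charpoly.discr) w)) *
          ((∏ w : PlacesOver L v, Literature.NumberTheory.GaloisRepresentations.IsNonarchimedeanLocalField.normAbs (w.1.adicCompletion L)
            (((((t' : ↥(unitaryGroupOfForm (conjLocal L (IsCMField.complexConj L) v) (cmLocalForm L 3 v))) : Gqs L v).val :
              GL (Fin 3) (UnitaryGroup.LocalRing L v)).val.det) w)) ^ 2)⁻¹))
      _ (fun t t' h => by simp only [h]) hDM t₀ ht₀
  · -- ### (6b) a COMPACT Cartan: the named socket `hJacT` (JAC-ELL C8's head), read with the constructed `Φ T`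
    obtain ⟨γ₀, hγ₀, hTeq⟩ := hShape T T.2
    obtain ⟨U, hUo, ht₀U, A₀, hA₀m, hA₀0, hA₀top, hJ⟩ :=
      hJacT (T : Subgroup (Gqs L v)) γ₀ hγ₀ hTeq (hcptA T T.2 hTM) (𝔇.μT (T : Subgroup (Gqs L v))) (hH T) (hI T) (hcoreT T T.2) t₀ ht₀
    refine ⟨U, hUo, ht₀U, A₀, hA₀m, hA₀0, hA₀top, fun V hVm hVU hVreg hVW => ?_⟩
    have htube : Φ T '' (A₀ ×ˢ V) = {y : Gqs L v | ∃ (x : Gqs L v) (t : ↥(T : Subgroup (Gqs L v))),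
        (QuotientGroup.mk x : Gqs L v ⧸ (T : Subgroup (Gqs L v))) ∈ A₀ ∧ t ∈ V ∧ y = x * t * x⁻¹} := by
      ext y
      constructor
      · rintro ⟨⟨q, t⟩, ⟨hq, ht⟩, rfl⟩
        obtain ⟨x, rfl⟩ := QuotientGroup.mk_surjective q
        exact ⟨x, t, hq, ht, hΦ T x t⟩
      · rintro ⟨x, t, hx, ht, rfl⟩
        exact ⟨(QuotientGroup.mk x, t), ⟨hx, ht⟩, hΦ T x t⟩
    rw [htube]
    exact hJ V hVm hVU hVreg hVW

end CM

end Summit.HodgeConjecture.HodgeConjecture.Cruxes.H413.F0P3cStCharTSWeylDatumPinsWIF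

end
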